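import Literature.NumberTheory.EllipticCurves.HeegnerPointsLevelTransport
import Literature.NumberTheory.EllipticCurves.HeegnerPointsSingularModuliField
import Literature.NumberTheory.EllipticCurves.ComplexMultiplicationClassPolynomialIrreducibleProofs
import Literature.NumberTheory.EllipticCurves.ModularParametrizationDegree
import Literature.NumberTheory.EllipticCurves.HeegnerHypothesisKroneckerProofs
import Literature.FieldTheory.AlgClosed.AutFixedSubfield
import HarnessLib

/-!
# The `K`-rationality of the Heegner point reduced to the `ℚ`-rationality of `Φ_N`
# (Darmon 2004, Thms. 3.6–3.7: the complex-multiplication half, proved)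

Topic `NumberTheory/EllipticCurves`.  The named fact
`Literature.NumberTheory.EllipticCurves.heegnerPointComplex_mem_range_map N W K`
(`HeegnerPointsRationality.lean`; leaf 4 of `exists_isHeegnerPoint`: the traced Heegner point
`∑_{[Q]} φ(τ_Q) ∈ E(ℂ)` comes from `E(K)`) rests, in Darmon's account (*Rational points on modular
elliptic curves*, §3), on two ingredients of a different nature:

1. **Complex multiplication / Shimura reciprocity** (Thm. 3.5, Thm. 3.7, and the first half of the
   proof of Thm. 3.6): the Heegner points `(𝒪_K, 𝔫, [𝔞])` of `X₀(N)` are defined over the Hilbert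
   class field `H` of `K` and permuted by `Gal(H/K)`;
2. **the `ℚ`-rationality of the modular parametrisation** (second half of the proof of Thm. 3.6:
   "since the map `X₀(N) → E` induced by `Φ_N` is a map of algebraic curves defined over `ℚ`";
   Knapp, *Elliptic Curves*, Thm. 11.74 and Remark: "`ν ∘ Φ : X₀(N) → E` defined over `ℚ`"),
   i.e. the Eichler–Shimura construction over `ℚ` together with Faltings' isogeny theorem.

This file **proves ingredient 1 completely** and reduces the fact to ingredient 2 alone, stated in
the elementary transport form in which it is used:

* `ModularParametrizationData.IsAutEquivariantOnHeegner Dt D` (a predicate on the datum, with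
  binders — not a named fact): for every automorphism `σ` of `ℂ` and Heegner forms `Q, Q'` of level
  `N` and discriminant `D` such that `σ` carries the level-`N` structure `(E_{τ_Q}, ⟨1/N⟩)` to
  `(E_{τ_{Q'}}, ⟨1/N⟩)` (`LevelTransport N σ τ_Q τ_{Q'}`, `LevelStructureTransport.lean`), one has
  `σ(φ(τ_Q)) = φ(τ_{Q'})` on `E(ℂ)` (coordinatewise action, `E` being defined over `ℚ`).  This is
  exactly what "`Φ_N : X₀(N) → E` is defined over `ℚ`" says at the CM points of `Y₀(N)(ℂ)`, the
  coarse moduli space of pairs (elliptic curve, cyclic subgroup of order `N`) (Diamond–Shurman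
  Thm. 1.5.1, §7.7; Shimura §6.7–6.8).  It holds for every datum `Dt` (whose `φ` is
  `[c] ∘ (ℂ/Λ_f ← X₀(N))`: `ℂ/Λ_f → E_f` is Shimura's `ℚ`-rational parametrisation, and the real
  multiplier `c` with `cΛ_f ⊆ Λ_E` is a `ℚ`-rational homomorphism `E_f → E` because `E_f` and `E`
  are `ℚ`-isogenous by Faltings and the `ℚ`-rational homomorphisms form a saturated subgroup of the
  rank-`≤ 2` group of all multipliers, as do the real ones) — but none of this is in the tree, so it
  is kept as the hypothesis.
* `heegnerPoints_perm_of_isAutEquivariantOnHeegner` — **Darmon Thm. 3.7 for the trace** (proved):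
  every `σ ∈ Gal(H_K/K)`, `H_K ⊂ ℂ` the field of singular moduli (`HeegnerPointsSingularModuliField`),
  permutes the points `φ(τ_Q) ∈ E(H_K)`, `Q` running over representatives of the Heegner forms with
  fixed `β`: extend `σ` to `Aut(ℂ)` (`AutFixedSubfield.lean`), transport the Heegner point
  (`exists_levelTransport_of_apply_sqrtDisc_eq`: same `𝔫`, i.e. same `β`), land on a representative
  by `Γ₀(N)`-invariance of `φ` (`φ_gamma0_smul_holds'`) and of `LevelTransport`, and get injectivity
  from the functoriality of `LevelTransport` and the irredundancy of the representatives.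
* `exists_point_of_isAutEquivariantOnHeegner` — **Darmon Thm. 3.6, "`Φ_N(τ) ∈ E(H)`"** (proved from
  the hypothesis): `φ(τ_Q)` is fixed by `Aut(ℂ/H_K)` (`levelTransport_self_of_apply_formJ_eq`), and
  the fixed field of `Aut(ℂ/H_K)` is `H_K` (`Complex.mem_subfield_of_forall_ringEquiv`).
* `heegnerPoints_galoisConj_of_isAutEquivariantOnHeegner`,
  `heegnerPointComplex_mem_range_map_of_isAutEquivariantOnHeegner` — the assembly with the tree's
  Galois descent of the trace (`HeegnerPointsGaloisDescent.lean`) and the (now proved) finiteness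
  and normality of `H_K/K` (`finiteDimensional_and_isGalois_singularModuliField` with
  `irreducible_classPolynomial_holds`): **leaf 4 follows from the `ℚ`-rationality of `Φ_N` alone.**

No named facts are introduced; the hypothesis is a predicate with binders, consumed inline.

## References

* H. Darmon, *Rational points on modular elliptic curves*, CBMS 101, AMS 2004: Thm. 3.5, Thm. 3.6
  and its proof (PDF p. 43), Thm. 3.7 (PDF p. 44), §3.7 (PDF p. 49). [Darmon2004]
* B. H. Gross, *Heegner points on `X₀(N)`*, in *Modular Forms* (Durham 1983), 1984, §I.1.
  [Gross1984]
* B. H. Gross, *Kolyvagin's work on modular elliptic curves*, LMS LNS 153 (1991), §1, §3.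
  [GrossLMS1991]
* A. W. Knapp, *Elliptic Curves*, Princeton 1993, Thm. 11.74 and Remarks (PDF p. 287). [Knapp1993]
* F. Diamond, J. Shurman, *A First Course in Modular Forms*, GTM 228, 2005, Thm. 1.5.1, §7.7.
  [DiamondShurman2005]
* G. Shimura, *Introduction to the arithmetic theory of automorphic functions*, 1971, §6.7–6.8,
  Thm. 6.31. [ShimuraIATAF1971]
-/

noncomputable section

open scoped Classical
open scoped MatrixGroups Cardinal

open Complex UpperHalfPlane CongruenceSubgroup PeriodPair NumberField
  Literature.NumberTheory.EllipticCurves.ModularForms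
  Literature.NumberTheory.QuadraticFields.BinaryQuadraticForm
  Literature.NumberTheory.QuadraticFields.Quadratic
  Literature.FieldTheory.AlgClosed

universe u

/-! ### Changing the scalars of an algebra homomorphism in `Point.map` -/

namespace WeierstrassCurve.Affine.Point

/-- `Point.map f P` only depends on the underlying function of the algebra homomorphism `f` (it acts
on coordinates), so the structure ring `S` of `f : F →ₐ[S] K` may be changed. A deliberate
dot-notation extension of Mathlib's `WeierstrassCurve.Affine.Point` namespace. [folklore] -/
theorem map_congr_fun {R S S' F K : Type*} [CommRing R] [CommRing S] [CommRing S'] [Field F]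
    [Field K] {W' : WeierstrassCurve.Affine R} [Algebra R S] [Algebra R S'] [Algebra R F]
    [Algebra S F] [Algebra S' F] [IsScalarTower R S F] [IsScalarTower R S' F] [Algebra R K]
    [Algebra S K] [Algebra S' K] [IsScalarTower R S K] [IsScalarTower R S' K] {f : F →ₐ[S] K}
    {f' : F →ₐ[S'] K} (h : ∀ x, f x = f' x) (P : (W'.baseChange F).toAffine.Point) :
    map f P = map f' P := by
  rcases P with _ | ⟨x, y, hP⟩
  · rfl
  · rw [map_some, map_some]
    simp only [some.injEq]
    exact ⟨h x, h y⟩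

end WeierstrassCurve.Affine.Point

namespace Literature.NumberTheory.EllipticCurves

/-! ### The hypothesis: `φ` is `Aut(ℂ)`-equivariant on Heegner points (transport form of
"`X₀(N) → E` is defined over `ℚ`") -/

namespace ModularForms.ModularParametrizationData

variable {W : WeierstrassCurve ℚ} {N : ℕ} [NeZero N]

/-- **`φ` is `Aut(ℂ/K)`-equivariant along level-`N` transport of Heegner points of discriminant
`D`.** For every field automorphism `σ` of `ℂ` fixing `√D = i√|D|` (i.e. fixing `K = ℚ(√D) ⊂ ℂ`
pointwise) and Heegner forms `Q, Q'` of level `N` and discriminant `D` such that `σ` carries the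
level-`N` structure of `τ_Q` to that of `τ_{Q'}`
(`LevelTransport N σ τ_Q τ_{Q'}`: `(E_{τ_Q}, ⟨1/N⟩)^σ ≅ (E_{τ_{Q'}}, ⟨1/N⟩)`), the point
`φ(τ_Q) ∈ E(ℂ)` is carried to `φ(τ_{Q'})` by `σ` acting on coordinates (`E` is defined over `ℚ`;
Mathlib `WeierstrassCurve.Affine.Point.map`).  This is the content, at the CM points, of "the map
`X₀(N) → E` induced by `Φ_N` is a map of algebraic curves defined over `ℚ`" (Darmon 2004, proof of
Thm. 3.6; Knapp 1993, Thm. 11.74, Remark: `ν ∘ Φ : X₀(N) → E` is defined over `ℚ`) on the coarse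
moduli space `Y₀(N)` of pairs `(E', C)` (Diamond–Shurman Thm. 1.5.1, §7.7), and it holds for the
derived parametrisation `φ = Dt.φ` of every datum (Eichler–Shimura over `ℚ`, Faltings' isogeny
theorem, and the saturation of `ℚ`-rational among real multipliers `ℂ/Λ_f → ℂ/Λ_E`).  A predicate
on the datum (explicit binders), used as a hypothesis; not asserted.
[cite: Darmon2004, Thm. 3.6, proof (PDF p. 43)] -/
def IsAutEquivariantOnHeegner (Dt : ModularParametrizationData W N) (D : ℤ) : Prop :=
  ∀ (σ : ℂ ≃+* ℂ) {Q Q' : ℤ × ℤ × ℤ}, σ (sqrtDisc D) = sqrtDisc D →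
    Q ∈ heegnerForms N D → Q' ∈ heegnerForms N D →
    LevelTransport N σ (heegnerTau Q) (heegnerTau Q') →
    WeierstrassCurve.Affine.Point.map (σ : ℂ →+* ℂ).toRatAlgHom (Dt.φ (heegnerTau Q)) =
      Dt.φ (heegnerTau Q')

/-- **The hypothesis in terms of the two modular functions `X = ℘_Λ(c·u)`, `Y = ℘_Λ'(c·u)`.**
`φ(τ) = uniformize(c·u(τ))`, `u = 2πi∫_{i∞}^τ f`, is `O` if `c·u(τ) ∈ Λ_E` and otherwise the
affine point `(℘(cu) − b₂/12, (℘'(cu) − a₁x − a₃)/2)` with `b₂, a₁, a₃ ∈ ℚ` fixed by `σ`; so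
`IsAutEquivariantOnHeegner` follows from (indeed is equivalent to) the same transport statement for
the values at Heegner points of the `Γ₀(N)`-invariant meromorphic functions `℘_Λ(c·u)`, `℘'_Λ(c·u)`
(`Λ = Dt.L.lattice ⊇ cΛ_f`, with rational invariants `c₄/12`, `c₆/216`) — the form in which the
`ℚ`-rationality of the analytic parametrisation is naturally proved (`℘_Λ(2πi∫f)` as a quotient of
cusp forms: the tree's `exists_weierstrassP_eichlerIntegral_presentation`; Shimura 1971, Thm. 7.14).
[cite: ShimuraIATAF1971, Thm. 7.14] -/
theorem isAutEquivariantOnHeegner_of_weierstrassP (Dt : ModularParametrizationData W N) {D : ℤ}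
    (h : ∀ (σ : ℂ ≃+* ℂ) {Q Q' : ℤ × ℤ × ℤ}, σ (sqrtDisc D) = sqrtDisc D →
      Q ∈ heegnerForms N D → Q' ∈ heegnerForms N D →
      LevelTransport N σ (heegnerTau Q) (heegnerTau Q') →
      ((Dt.c : ℂ) * eichlerIntegral Dt.f (heegnerTau Q) ∈ Dt.L.lattice ↔
          (Dt.c : ℂ) * eichlerIntegral Dt.f (heegnerTau Q') ∈ Dt.L.lattice) ∧
        ((Dt.c : ℂ) * eichlerIntegral Dt.f (heegnerTau Q) ∉ Dt.L.lattice →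
          σ (℘[Dt.L] ((Dt.c : ℂ) * eichlerIntegral Dt.f (heegnerTau Q))) =
              ℘[Dt.L] ((Dt.c : ℂ) * eichlerIntegral Dt.f (heegnerTau Q')) ∧
            σ (℘'[Dt.L] ((Dt.c : ℂ) * eichlerIntegral Dt.f (heegnerTau Q))) =
              ℘'[Dt.L] ((Dt.c : ℂ) * eichlerIntegral Dt.f (heegnerTau Q')))) :
    Dt.IsAutEquivariantOnHeegner D := by
  intro σ Q Q' hσ hQ hQ' hT
  obtain ⟨hiff, hval⟩ := h σ hσ hQ hQ' hT
  set z : ℂ := (Dt.c : ℂ) * eichlerIntegral Dt.f (heegnerTau Q) with hz_def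
  set z' : ℂ := (Dt.c : ℂ) * eichlerIntegral Dt.f (heegnerTau Q') with hz'_def
  change WeierstrassCurve.Affine.Point.map _ (Dt.uniformize z) = Dt.uniformize z'
  by_cases hz : z ∈ Dt.L.lattice
  · rw [(Dt.uniformize_eq_zero_iff z).mpr hz, (Dt.uniformize_eq_zero_iff z').mpr (hiff.mp hz),
      map_zero]
  · have hz' : z' ∉ Dt.L.lattice := fun h' ↦ hz (hiff.mpr h')
    obtain ⟨h₁, h₂⟩ := hval hz
    obtain ⟨hn, hspec⟩ := Dt.uniformize_spec z hz
    obtain ⟨hn', hspec'⟩ := Dt.uniformize_spec z' hz'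
    have hσq : ∀ q : ℚ, σ (algebraMap ℚ ℂ q) = algebraMap ℚ ℂ q := fun q ↦ by
      rw [eq_ratCast, map_ratCast]
    rw [hspec, hspec', WeierstrassCurve.Affine.Point.map_some, WeierstrassCurve.Affine.Point.some.injEq]
    refine ⟨?_, ?_⟩
    · simp only [RingHom.toRatAlgHom_apply, RingEquiv.coe_toRingHom, WeierstrassCurve.baseChange,
        WeierstrassCurve.map_b₂, map_sub, map_div₀, map_ofNat, hσq, h₁]
    · simp only [RingHom.toRatAlgHom_apply, RingEquiv.coe_toRingHom, WeierstrassCurve.baseChange,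
        WeierstrassCurve.map_b₂, WeierstrassCurve.map_a₁, WeierstrassCurve.map_a₃, map_sub,
        map_div₀, map_mul, map_ofNat, hσq, h₁, h₂]

end ModularForms.ModularParametrizationData

/-! ### Automorphisms of `ℂ` over `K` and over `H_K` -/

section AutK

variable {K : Type u} [Field K] [NumberField K]

/-- An automorphism of `ℂ` fixing `ι(K)` pointwise fixes `√d_K = i√|d_K|` (`= ±ι(δ)` for
`δ ∈ 𝓞 K` with `δ² = d_K`, the tree's `exists_sq_eq_discr`). [folklore] -/
theorem apply_sqrtDisc_discr_eq (hK : IsImaginaryQuadratic K) (ι : K →+* ℂ) {σ : ℂ ≃+* ℂ}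
    (h : ∀ x : K, σ (ι x) = ι x) :
    σ (sqrtDisc (NumberField.discr K)) = sqrtDisc (NumberField.discr K) := by
  obtain ⟨-, -, δ, -, hδ⟩ := exists_sq_eq_discr hK.1
  have hδK : (algebraMap (𝓞 K) K δ) ^ 2 = (NumberField.discr K : K) := by
    rw [← map_pow, hδ, map_intCast]
  have hδC : (ι (algebraMap (𝓞 K) K δ)) ^ 2 = (NumberField.discr K : ℂ) := by
    rw [← map_pow, hδK, map_intCast]
  have hs : (ι (algebraMap (𝓞 K) K δ)) ^ 2 = sqrtDisc (NumberField.discr K) ^ 2 := by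
    rw [hδC, sqrtDisc_sq hK.discr_neg]
  rcases sq_eq_sq_iff_eq_or_eq_neg.mp hs with h' | h'
  · rw [← h', h]
  · rw [eq_neg_iff_add_eq_zero, add_comm, ← eq_neg_iff_add_eq_zero] at h'
    rw [h', map_neg, h]

variable (K) in
/-- The field of singular moduli `H_K ⊂ ℂ` is countable (a number field, by
`numberField_singularModuliField` with the tree's theorem `irreducible_classPolynomial_holds`).
[folklore] -/
theorem cardinalMk_singularModuliField_le (hK : IsImaginaryQuadratic K) (ι : K →+* ℂ) :
    #(singularModuliField K ι) ≤ ℵ₀ := by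
  haveI := (finiteDimensional_and_isGalois_singularModuliField irreducible_classPolynomial_holds hK ι).1
  haveI : FiniteDimensional ℚ (singularModuliField K ι) :=
    Module.Finite.trans K (singularModuliField K ι)
  haveI : Algebra.IsAlgebraic ℚ (singularModuliField K ι) := Algebra.IsAlgebraic.of_finite ℚ _
  exact Subfield.cardinalMk_le_aleph0_of_isAlgebraic _

/-- **`Gal(H_K/K)` is induced by `Aut(ℂ/K)`**: every `K`-automorphism `σ₀` of the field of
singular moduli `H_K ⊂ ℂ` is the restriction of an automorphism `σ` of `ℂ`
(`Complex.exists_ringEquiv_apply_eq_of_subfield`), which then fixes `ι(K)` pointwise.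
[folklore] -/
theorem exists_ringEquiv_restrict_eq (hK : IsImaginaryQuadratic K) (ι : K →+* ℂ)
    (σ₀ : singularModuliField K ι ≃ₐ[K] singularModuliField K ι) :
    ∃ σ : ℂ ≃+* ℂ, (∀ x : singularModuliField K ι, σ x = σ₀ x) ∧ ∀ y : K, σ (ι y) = ι y := by
  obtain ⟨σ, hσ⟩ := Complex.exists_ringEquiv_apply_eq_of_subfield (singularModuliField K ι)
    (cardinalMk_singularModuliField_le K hK ι)
    ((singularModuliField K ι).subtype.comp (σ₀ : singularModuliField K ι ≃ₐ[K] _).toRingEquiv.toRingHom)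
  refine ⟨σ, fun x ↦ hσ x, fun y ↦ ?_⟩
  have h := hσ (algebraMap K (singularModuliField K ι) y)
  rw [coe_algebraMap_singularModuliField] at h
  rw [h]
  change ((σ₀ (algebraMap K (singularModuliField K ι) y) : singularModuliField K ι) : ℂ) = ι y
  rw [AlgEquiv.commutes, coe_algebraMap_singularModuliField]

end AutK

/-! ### Darmon Thm. 3.7 for the trace: `Gal(H_K/K)` permutes the Heegner points (proved) -/

section CM

variable {N : ℕ} [NeZero N] {W : WeierstrassCurve ℚ} {K : Type u} [Field K] [NumberField K]

/-- **`Aut(ℂ/K)` permutes the classes of Heegner forms with fixed `β`, compatibly with `φ`.** For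
`σ ∈ Aut(ℂ)` fixing `ι(K)` and a Heegner datum `H` (residue `β`, representatives `reps`) of
discriminant `d_K` under the Heegner hypothesis, there is a permutation `e` of `reps` with
`LevelTransport N σ τ_q τ_{e q}` for all `q`: existence of a target with the same `β`
(`exists_levelTransport_of_apply_sqrtDisc_eq`), completeness of `reps` and `Γ₀(N)`-invariance of
`LevelTransport`; injectivity by its functoriality (`LevelTransport.exists_gamma0_smul_eq_left`) and
the irredundancy of `reps`. (Gross 1984, §I.1: `Gal(H/K) ≅ Pic(𝒪_K)` acts simply transitively on
the `(𝒪, 𝔫, [𝔞])`; Darmon 2004, Thm. 3.7.) [cite: Darmon2004, Thm. 3.7 (PDF p. 44)] -/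
theorem exists_perm_levelTransport (hK : IsImaginaryQuadratic K) (hH : SatisfiesHeegnerHypothesis N K)
    (H : HeegnerDatum N (NumberField.discr K)) {σ : ℂ ≃+* ℂ}
    (hσ : σ (sqrtDisc (NumberField.discr K)) = sqrtDisc (NumberField.discr K)) :
    ∃ e : Equiv.Perm H.reps, ∀ q : H.reps, LevelTransport N σ (heegnerTau q) (heegnerTau (e q)) := by
  have hND : IsCoprime (N : ℤ) (NumberField.discr K) := by
    have h := Literature.SatisfiesHeegnerHypothesis.coprime_discr hK.1 hH
    refine Int.isCoprime_iff_gcd_eq_one.mpr ?_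
    rw [Int.gcd_eq_natAbs, Int.natAbs_natCast]
    exact h
  have key : ∀ q : H.reps, ∃ r : H.reps, LevelTransport N σ (heegnerTau q) (heegnerTau r) := by
    intro q
    obtain ⟨hq, hqβ⟩ := H.mem_heegnerForms q q.2
    obtain ⟨Q', hQ', hβ', hT⟩ :=
      exists_levelTransport_of_apply_sqrtDisc_eq hK hND H.dvd_sq_sub hσ hq hqβ
    obtain ⟨r, hr, γ, hγ⟩ := H.exists_isGamma0Equiv Q' hQ' hβ'
    refine ⟨⟨r, hr⟩, hT.of_gamma0_smul_eq_right (γ := γ) ?_⟩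
    rw [← hγ, Subgroup.smul_def]
  choose e he using key
  have hinj : Function.Injective e := by
    intro q₁ q₂ h12
    have h₁ := he q₁
    rw [h12] at h₁
    obtain ⟨γ, hγ⟩ := h₁.exists_gamma0_smul_eq_left (he q₂)
    by_contra hne
    exact H.pairwise_not_isGamma0Equiv q₁.2 q₂.2 (fun h ↦ hne (Subtype.ext h))
      ⟨γ, by rw [Subgroup.smul_def]; exact hγ⟩
  exact ⟨Equiv.ofBijective e (Finite.injective_iff_bijective.mp hinj), fun q ↦ he q⟩

/-- **Darmon 2004, Thm. 3.7, for the trace (proved from the `ℚ`-rationality of `φ`): `Gal(H_K/K)`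
permutes the Heegner points `φ(τ_Q) ∈ E(H_K)`.**  For `K` imaginary quadratic under the Heegner
hypothesis, a Heegner datum `H` of discriminant `d_K`, points `P_q ∈ E(H_K)` over the field of
singular moduli `H_K ⊂ ℂ` with `P_q ↦ φ(τ_q)` in `E(ℂ)`, and `σ₀ ∈ Gal(H_K/K)`: `σ₀ P_q = P_{e q}` for
a permutation `e` of the representatives.  Proof: `σ₀` extends to `σ ∈ Aut(ℂ/K)`
(`exists_ringEquiv_restrict_eq`), `σ` permutes the classes with fixed `β`
(`exists_perm_levelTransport` — Shimura reciprocity in transport form), and `φ` is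
`σ`-equivariant along the transport by hypothesis; conclude by injectivity of `E(H_K) → E(ℂ)`.
("`Φ_N(α ⋆ τ) = rec(α⁻¹) Φ_N(τ)`", Darmon Thm. 3.7; Gross 1991, (3.4).)
[cite: Darmon2004, Thm. 3.7 (PDF p. 44)] -/
theorem heegnerPoints_perm_of_isAutEquivariantOnHeegner [W.IsElliptic] (hK : IsImaginaryQuadratic K)
    (hH : SatisfiesHeegnerHypothesis N K) (Dt : ModularParametrizationData W N)
    (hφ : Dt.IsAutEquivariantOnHeegner (NumberField.discr K))
    (H : HeegnerDatum N (NumberField.discr K)) (ι : K →+* ℂ)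
    (P : H.reps → (W.baseChange (singularModuliField K ι)).toAffine.Point)
    (hP : ∀ q : H.reps,
      WeierstrassCurve.Affine.Point.map (singularModuliField K ι).subtype.toRatAlgHom (P q) =
        Dt.φ (heegnerTau q))
    (σ₀ : singularModuliField K ι ≃ₐ[K] singularModuliField K ι) :
    ∃ e : Equiv.Perm H.reps, ∀ q : H.reps,
      WeierstrassCurve.Affine.Point.map
        (σ₀ : singularModuliField K ι →ₐ[K] singularModuliField K ι) (P q) = P (e q) := by
  obtain ⟨σ, hσF, hσK⟩ := exists_ringEquiv_restrict_eq hK ι σ₀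
  have hσD := apply_sqrtDisc_discr_eq hK ι hσK
  obtain ⟨e, he⟩ := exists_perm_levelTransport hK hH H hσD
  refine ⟨e, fun q ↦ ?_⟩
  apply WeierstrassCurve.Affine.Point.map_injective
    (f := (singularModuliField K ι).subtype.toRatAlgHom)
  rw [hP (e q), ← hφ σ hσD (H.mem_heegnerForms q q.2).1 (H.mem_heegnerForms _ (e q).2).1 (he q),
    ← hP q, WeierstrassCurve.Affine.Point.map_map]
  have hswap : WeierstrassCurve.Affine.Point.map
      (σ₀ : singularModuliField K ι →ₐ[K] singularModuliField K ι) (P q) =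
      WeierstrassCurve.Affine.Point.map
        (σ₀ : singularModuliField K ι ≃ₐ[K] singularModuliField K ι).toRingEquiv.toRingHom.toRatAlgHom
        (P q) :=
    WeierstrassCurve.Affine.Point.map_congr_fun (fun _ ↦ rfl) _
  rw [hswap, WeierstrassCurve.Affine.Point.map_map]
  exact WeierstrassCurve.Affine.Point.map_congr_fun (fun x ↦ (hσF x).symm) _

/-- **Darmon 2004, Thm. 3.6, "`Φ_N(τ) ∈ E(H)`" (proved from the `ℚ`-rationality of `φ`).**  For
`K` imaginary quadratic under the Heegner hypothesis, `β² ≡ d_K (mod 4N)`, and a Heegner form `Q` of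
level `N`, discriminant `d_K` with `B ≡ β (mod 2N)`, the point `φ(τ_Q) ∈ E(ℂ)` is the image of a
point of `E(H_K)`, `H_K ⊂ ℂ` the field of singular moduli (= `K(j(𝒪_K))`, the Hilbert class
field): every `σ ∈ Aut(ℂ/H_K)` fixes `√d_K` and `j(τ_Q) ∈ H_K`
(`kleinJ_heegnerTau_mem_singularModuliField`, Darmon Thm. 3.5), hence fixes the level-`N` structure
of `τ_Q` (`levelTransport_self_of_apply_formJ_eq`), hence `φ(τ_Q)` by hypothesis; and the fixed
field of `Aut(ℂ/H_K)` is `H_K` (`Complex.mem_subfield_of_forall_ringEquiv`).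
[cite: Darmon2004, Thm. 3.6 (PDF p. 43)] -/
theorem exists_point_of_isAutEquivariantOnHeegner [W.IsElliptic] (hK : IsImaginaryQuadratic K)
    (hH : SatisfiesHeegnerHypothesis N K) (Dt : ModularParametrizationData W N)
    (hφ : Dt.IsAutEquivariantOnHeegner (NumberField.discr K)) (ι : K →+* ℂ) {β : ℤ}
    (hβD : (4 * N : ℤ) ∣ β ^ 2 - NumberField.discr K) {Q : ℤ × ℤ × ℤ}
    (hQ : Q ∈ heegnerForms N (NumberField.discr K)) (hQβ : Q.2.1 ≡ β [ZMOD 2 * N]) :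
    ∃ P : (W.baseChange (singularModuliField K ι)).toAffine.Point,
      WeierstrassCurve.Affine.Point.map (singularModuliField K ι).subtype.toRatAlgHom P =
        Dt.φ (heegnerTau Q) := by
  set F := singularModuliField K ι with hF_def
  have hND : IsCoprime (N : ℤ) (NumberField.discr K) := by
    have h := Literature.SatisfiesHeegnerHypothesis.coprime_discr hK.1 hH
    refine Int.isCoprime_iff_gcd_eq_one.mpr ?_
    rw [Int.gcd_eq_natAbs, Int.natAbs_natCast]
    exact h
  have hfix : ∀ σ : ℂ ≃+* ℂ, (∀ x ∈ F, σ x = x) →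
      WeierstrassCurve.Affine.Point.map (σ : ℂ →+* ℂ).toRatAlgHom (Dt.φ (heegnerTau Q)) =
        Dt.φ (heegnerTau Q) := by
    intro σ hσ
    have hσD : σ (sqrtDisc (NumberField.discr K)) = sqrtDisc (NumberField.discr K) :=
      apply_sqrtDisc_discr_eq hK ι fun x ↦ hσ _ (apply_mem_singularModuliField ι x)
    refine hφ σ hσD hQ hQ (levelTransport_self_of_apply_formJ_eq hK.discr_neg hND hβD hσD hQ hQβ ?_)
    · rw [formJ_def, ← kleinJ_eq_periodPair_j]
      exact hσ _ (kleinJ_heegnerTau_mem_singularModuliField hK ι hQ)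
  have hFc : #F ≤ ℵ₀ := cardinalMk_singularModuliField_le K hK ι
  rcases hP₀ : Dt.φ (heegnerTau Q) with _ | ⟨x, y, hxy⟩
  · exact ⟨0, rfl⟩
  · have hcoord : ∀ σ : ℂ ≃+* ℂ, (∀ z ∈ F, σ z = z) → σ x = x ∧ σ y = y := by
      intro σ hσ
      have h := hfix σ hσ
      rw [hP₀, WeierstrassCurve.Affine.Point.map_some] at h
      have h12 := WeierstrassCurve.Affine.Point.some.inj h
      exact ⟨h12.1, h12.2⟩
    have hx : x ∈ F := Complex.mem_subfield_of_forall_ringEquiv F hFc fun σ hσ ↦ (hcoord σ hσ).1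
    have hy : y ∈ F := Complex.mem_subfield_of_forall_ringEquiv F hFc fun σ hσ ↦ (hcoord σ hσ).2
    have h₀ : (W.baseChange F).toAffine.Nonsingular ⟨x, hx⟩ ⟨y, hy⟩ :=
      (WeierstrassCurve.Affine.baseChange_nonsingular W (f := F.subtype.toRatAlgHom)
        F.subtype.injective ⟨x, hx⟩ ⟨y, hy⟩).mp hxy
    exact ⟨.some ⟨x, hx⟩ ⟨y, hy⟩ h₀, rfl⟩

/-- **The CM fact `heegnerPoints_galoisConj` from the `ℚ`-rationality of `φ` alone.**  Granted that
the parametrisation `φ` of every datum `Dt` at level `N` is `Aut(ℂ)`-equivariant along level-`N`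
transport of the Heegner points of discriminant `d_K` (`IsAutEquivariantOnHeegner`: "`X₀(N) → E` is
defined over `ℚ`", Darmon Thm. 3.6, proof), the Heegner points `φ(τ_Q)`, `Q ∈ H.reps`, come from a
`Gal(H_K/K)`-permuted family over the finite Galois extension `H_K/K` (the field of singular
moduli, finite Galois by `finiteDimensional_and_isGalois_singularModuliField` and the tree's theorem
`irreducible_classPolynomial_holds`): `exists_point_of_isAutEquivariantOnHeegner` (Thm. 3.6) and
`heegnerPoints_perm_of_isAutEquivariantOnHeegner` (Thm. 3.7).  All of the complex-multiplication
input of Darmon's Thms. 3.5–3.7 is thereby proved in the tree.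
[cite: Darmon2004, Thm. 3.6 and Thm. 3.7 (PDF pp. 43–44)] -/
theorem heegnerPoints_galoisConj_of_isAutEquivariantOnHeegner
    (hφ : ∀ [W.IsElliptic] (Dt : ModularParametrizationData W N),
      Dt.IsAutEquivariantOnHeegner (NumberField.discr K)) :
    heegnerPoints_galoisConj N W K := by
  intro _ hK hH Dt H ι
  obtain ⟨-, hgal⟩ :=
    finiteDimensional_and_isGalois_singularModuliField irreducible_classPolynomial_holds hK ι
  haveI := numberField_singularModuliField irreducible_classPolynomial_holds hK ι
  choose P hP using fun q : H.reps ↦ exists_point_of_isAutEquivariantOnHeegner hK hH Dt (hφ Dt) ι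
    H.dvd_sq_sub (H.mem_heegnerForms q q.2).1 (H.mem_heegnerForms q q.2).2
  exact ⟨singularModuliField K ι, inferInstance, inferInstance, inferInstance, hgal,
    (singularModuliField K ι).subtype, P, subtype_comp_algebraMap_singularModuliField ι, hP,
    fun σ ↦ heegnerPoints_perm_of_isAutEquivariantOnHeegner hK hH Dt (hφ Dt) H ι P hP σ⟩

/-- **Leaf 4 (`heegnerPointComplex_mem_range_map N W K`: the traced Heegner point `∑_{[Q]} φ(τ_Q)`
lies in the image of `E(K)`) from the `ℚ`-rationality of `φ` alone** — Darmon 2004, §3.7,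
"`P_K = Trace_{H_1/K}(P_1) ∈ E(K)`": the CM half (Thms. 3.5–3.7) is proved above, the descent of
the trace is the tree's `heegnerPointComplex_mem_range_map_of_galoisConj`; what remains assumed is
that `X₀(N) → E` is defined over `ℚ` (`IsAutEquivariantOnHeegner`, for the data at level `N`).
[cite: Darmon2004, §3.7 (PDF p. 49)] -/
theorem heegnerPointComplex_mem_range_map_of_isAutEquivariantOnHeegner
    (hφ : ∀ [W.IsElliptic] (Dt : ModularParametrizationData W N),
      Dt.IsAutEquivariantOnHeegner (NumberField.discr K)) :
    heegnerPointComplex_mem_range_map N W K :=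
  heegnerPointComplex_mem_range_map_of_galoisConj
    (heegnerPoints_galoisConj_of_isAutEquivariantOnHeegner hφ)

/-- **`exists_isHeegnerPoint W K` from the Modularity theorem and the `ℚ`-rationality of `φ`**: for
`W/ℚ` a globally minimal elliptic curve and `K` imaginary quadratic satisfying the Heegner hypothesis
for `N_E`, some `P ∈ E(K)` is a Heegner point of level `N_E` — granted
`nonempty_modularParametrizationData` (BCDT 2001) and `IsAutEquivariantOnHeegner` for the data at
level `N_E` (the tree's `exists_isHeegnerPoint_of_modularity_of_galoisConj` with the CM fact now
proved from the latter). [cite: Darmon2004, Thm. 3.6 and §3.7] -/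
theorem exists_isHeegnerPoint_of_modularity_of_isAutEquivariantOnHeegner
    (h₁ : nonempty_modularParametrizationData)
    (hφ : ∀ [NeZero (W.conductorNorm ℤ)] [W.IsElliptic]
      (Dt : ModularParametrizationData W (W.conductorNorm ℤ)),
      Dt.IsAutEquivariantOnHeegner (NumberField.discr K)) :
    exists_isHeegnerPoint W K :=
  exists_isHeegnerPoint_of_modularity_of_galoisConj W K h₁ fun {_} ↦
    heegnerPoints_galoisConj_of_isAutEquivariantOnHeegner fun {_} Dt ↦ hφ Dt

end CM

end Literature.NumberTheory.EllipticCurves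

end
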